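import Mathlib
import Summits.Ventures.PercRepro2.MixChordRoot

/-!
# The exploration-martingale decomposition of the (MIX-CHORD) deficit — vocabulary, pinning
identities, the two-point law of total covariance (blind cell PercRepro2, night-1 g19;
proofs/NIGHT1-G19.md §3; the identity itself is in `MixChordDecomp.lean`)

Write `G = Gc / (D·Z) = Z·A − D·B` with `A = Cov_Q(σ_b, F)`, `B = Cov_PD(1_{bU}, 1_{oU})`,
`F = σ_o + σ₃(γ − 1_{oU})`, `γ = D_o / D` (`Gcond`, `covQ`, `covPD`, `gam`).  Along ANY edge `e`
every mass is the mixture `q·M¹ + (1 − q)·M⁰` of its values at `p[e ↦ 1]`, `p[e ↦ 0]`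
(`prob_eq_pin`), and the law of total covariance for the status of `e` under `P(·|Q)` and
`P(·|PD)` gives the EXACT identity

`G − q·G¹ − (1 − q)·G⁰ = T_γ + T_Q + T_PD`,

`T_Q = Z·π(1 − π)·(E_{Q¹}[σ_b] − E_{Q⁰}[σ_b])·(E_{Q¹}[F] − E_{Q⁰}[F])` (both `F` at the parent's
`γ`; `π = q·Z¹/Z = P(e open | Q)`), `T_PD = −D·π_D(1 − π_D)·(P(bU|PD¹) − P(bU|PD⁰))·(P(oU|PD¹) −
P(oU|PD⁰))` (`π_D = q·D¹/D`), `T_γ = −(γ¹ − γ⁰)·[q·Z¹(1 − π_D)·C¹ − (1 − q)·Z⁰·π_D·C⁰]` with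
`C = Cov_Q(σ_b, σ₃)` (`covQ3`) — the children's `F` use their own `γ`.

(MIX-CHORD) along `e` reads `T_γ + T_Q + T_PD ≥ −q·(1 − D¹Z¹/(D·Z))·G¹` (`mixChord_iff_decomp`).
`T_Q ≥ 0` along every root edge at `a₁` (`MixChordPieces.condMean_sb_update_ge` for `Δσ_b`;
`ΔF ≥ 0` census-true), `C⁰, C¹ ≥ 0` (`covQ_sb_s3_nonneg`); `T_PD` and `T_γ` are indefinite.

Own code; standard axioms.
-/

namespace Summit.Ventures.PercRepro2

open UnionCluster CovForm

namespace Mix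

section Defs

variable {V : Type*} {E : Type*} [Fintype E] [DecidableEq E] [DecidableEq V] {R : Type*}
  [Field R] [LinearOrder R]

variable (p : E → R) (ends : E → Sym2 V) (o a₁ a₂ a₃ b : V)

/-- `γ = D_o / D`. -/
noncomputable def gam : R := Do p ends o a₁ a₂ a₃ / prob p (PDEvent ends a₁ a₂ a₃)

/-- `E_Q[σ_b] = −gap / Z` (the conditional mean under `Q`). -/
noncomputable def condEsb : R := -gap p ends a₁ a₂ b / prob p (avoidAll ends a₂ {a₁})

/-- `E_Q[F]` at a prescribed `γ`: `(E_Q[σ_o] + γ E_Q[σ₃] − E_Q[σ₃ 1_{oU}]) / Z`. -/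
noncomputable def condEF (γ : R) : R :=
  (EQo p ends o a₁ a₂ + γ * EQ3 p ends a₁ a₂ a₃ - EQ3o p ends o a₁ a₂ a₃) /
    prob p (avoidAll ends a₂ {a₁})

/-- `E_Q[σ_b F]` at a prescribed `γ`. -/
noncomputable def condEsbF (γ : R) : R :=
  (EQbo p ends o a₁ a₂ b + γ * EQb3 p ends a₁ a₂ a₃ b - EQb3o p ends o a₁ a₂ a₃ b) /
    prob p (avoidAll ends a₂ {a₁})

/-- `A = Cov_Q(σ_b, F)` at a prescribed `γ`. -/
noncomputable def covQ (γ : R) : R :=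
  condEsbF p ends o a₁ a₂ a₃ b γ - condEsb p ends a₁ a₂ b * condEF p ends o a₁ a₂ a₃ γ

/-- `B = Cov_PD(1_{bU}, 1_{oU})`. -/
noncomputable def covPD : R :=
  PDbo p ends o a₁ a₂ a₃ b / prob p (PDEvent ends a₁ a₂ a₃) -
    PDb p ends a₁ a₂ a₃ b / prob p (PDEvent ends a₁ a₂ a₃) *
      (Do p ends o a₁ a₂ a₃ / prob p (PDEvent ends a₁ a₂ a₃))

/-- `C = Cov_Q(σ_b, σ₃)`. -/
noncomputable def covQ3 : R :=
  EQb3 p ends a₁ a₂ a₃ b / prob p (avoidAll ends a₂ {a₁}) -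
    condEsb p ends a₁ a₂ b * (EQ3 p ends a₁ a₂ a₃ / prob p (avoidAll ends a₂ {a₁}))

/-- `G(γ) = Z·A(γ) − D·B`. -/
noncomputable def Gcond (γ : R) : R :=
  prob p (avoidAll ends a₂ {a₁}) * covQ p ends o a₁ a₂ a₃ b γ -
    prob p (PDEvent ends a₁ a₂ a₃) * covPD p ends o a₁ a₂ a₃ b

end Defs

section Pin

variable {V : Type*} {E : Type*} [Fintype E] [DecidableEq E] [DecidableEq V] {R : Type*}
  [Field R] [LinearOrder R] [IsStrictOrderedRing R]

variable (p : E → R) (ends : E → Sym2 V) (o a₁ a₂ a₃ b : V) (e : E)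

omit [DecidableEq V] [LinearOrder R] [IsStrictOrderedRing R] in
/-- The pinning identity for `E_Q[σ_b σ₃]`. -/
lemma EQb3_pin : EQb3 p ends a₁ a₂ a₃ b =
    p e * EQb3 (Function.update p e 1) ends a₁ a₂ a₃ b +
      (1 - p e) * EQb3 (Function.update p e 0) ends a₁ a₂ a₃ b := by
  unfold EQb3; simp only [prob_eq_pin p _ e]; ring

omit [DecidableEq V] [LinearOrder R] [IsStrictOrderedRing R] in
/-- The pinning identity for `E_Q[σ₃]`. -/
lemma EQ3_pin : EQ3 p ends a₁ a₂ a₃ =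
    p e * EQ3 (Function.update p e 1) ends a₁ a₂ a₃ +
      (1 - p e) * EQ3 (Function.update p e 0) ends a₁ a₂ a₃ := by
  unfold EQ3; simp only [prob_eq_pin p _ e]; ring

omit [DecidableEq V] [LinearOrder R] [IsStrictOrderedRing R] in
/-- The pinning identity for `E_Q[σ_o]`. -/
lemma EQo_pin : EQo p ends o a₁ a₂ =
    p e * EQo (Function.update p e 1) ends o a₁ a₂ +
      (1 - p e) * EQo (Function.update p e 0) ends o a₁ a₂ := by
  unfold EQo; simp only [prob_eq_pin p _ e]; ring

omit [DecidableEq V] [LinearOrder R] [IsStrictOrderedRing R] in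
/-- The pinning identity for `E_Q[σ₃ 1_{oU}]`. -/
lemma EQ3o_pin : EQ3o p ends o a₁ a₂ a₃ =
    p e * EQ3o (Function.update p e 1) ends o a₁ a₂ a₃ +
      (1 - p e) * EQ3o (Function.update p e 0) ends o a₁ a₂ a₃ := by
  unfold EQ3o; simp only [prob_eq_pin p _ e]; ring

omit [DecidableEq V] [LinearOrder R] [IsStrictOrderedRing R] in
/-- The pinning identity for `E_Q[σ_b σ_o]`. -/
lemma EQbo_pin : EQbo p ends o a₁ a₂ b =
    p e * EQbo (Function.update p e 1) ends o a₁ a₂ b +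
      (1 - p e) * EQbo (Function.update p e 0) ends o a₁ a₂ b := by
  unfold EQbo; simp only [prob_eq_pin p _ e]; ring

omit [DecidableEq V] [LinearOrder R] [IsStrictOrderedRing R] in
/-- The pinning identity for `E_Q[σ_b σ₃ 1_{oU}]`. -/
lemma EQb3o_pin : EQb3o p ends o a₁ a₂ a₃ b =
    p e * EQb3o (Function.update p e 1) ends o a₁ a₂ a₃ b +
      (1 - p e) * EQb3o (Function.update p e 0) ends o a₁ a₂ a₃ b := by
  unfold EQb3o; simp only [prob_eq_pin p _ e]; ring

omit [DecidableEq V] [LinearOrder R] [IsStrictOrderedRing R] in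
/-- The pinning identity for `P(PD, b ∈ U)`. -/
lemma PDb_pin : PDb p ends a₁ a₂ a₃ b =
    p e * PDb (Function.update p e 1) ends a₁ a₂ a₃ b +
      (1 - p e) * PDb (Function.update p e 0) ends a₁ a₂ a₃ b := by
  unfold PDb; simp only [prob_eq_pin p _ e]; ring

omit [DecidableEq V] [LinearOrder R] [IsStrictOrderedRing R] in
/-- The pinning identity for `P(PD, b ∈ U, o ∈ U)`. -/
lemma PDbo_pin : PDbo p ends o a₁ a₂ a₃ b =
    p e * PDbo (Function.update p e 1) ends o a₁ a₂ a₃ b +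
      (1 - p e) * PDbo (Function.update p e 0) ends o a₁ a₂ a₃ b := by
  unfold PDbo; simp only [prob_eq_pin p _ e]; ring

omit [DecidableEq V] [LinearOrder R] [IsStrictOrderedRing R] in
/-- The pinning identity for `D_o`. -/
lemma Do_pin : Do p ends o a₁ a₂ a₃ =
    p e * Do (Function.update p e 1) ends o a₁ a₂ a₃ +
      (1 - p e) * Do (Function.update p e 0) ends o a₁ a₂ a₃ := by
  unfold Do; simp only [prob_eq_pin p _ e]; ring

omit [DecidableEq V] [LinearOrder R] [IsStrictOrderedRing R] in
/-- The pinning identity for `gap`. -/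
lemma gap_pin : gap p ends a₁ a₂ b =
    p e * gap (Function.update p e 1) ends a₁ a₂ b +
      (1 - p e) * gap (Function.update p e 0) ends a₁ a₂ b := by
  unfold gap; simp only [prob_eq_pin p _ e]; ring

end Pin

section Decomp

variable {V : Type*} {E : Type*} [Fintype E] [DecidableEq E] [DecidableEq V] {R : Type*}
  [Field R] [LinearOrder R] [IsStrictOrderedRing R]

omit [Fintype E] [DecidableEq E] [DecidableEq V] [LinearOrder R] [IsStrictOrderedRing R] in
/-- **The law of total covariance for a two-point mixture**, cleared: with `Z = q Z₁ + (1 − q) Z₀`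
and the masses `u, v, w` mixed the same way, `cov = w/Z − (u/Z)(v/Z)` satisfies
`Z·cov − q Z₁ cov₁ − (1 − q) Z₀ cov₀ = Z·π(1 − π)·(u₁/Z₁ − u₀/Z₀)·(v₁/Z₁ − v₀/Z₀)`, `π = q Z₁/Z`. -/
lemma totalCov_mix (q Z₁ Z₀ u₁ u₀ v₁ v₀ w₁ w₀ : R) (hZ1 : Z₁ ≠ 0) (hZ0 : Z₀ ≠ 0)
    (hZ : q * Z₁ + (1 - q) * Z₀ ≠ 0) :
    (q * Z₁ + (1 - q) * Z₀) *
        ((q * w₁ + (1 - q) * w₀) / (q * Z₁ + (1 - q) * Z₀) -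
          (q * u₁ + (1 - q) * u₀) / (q * Z₁ + (1 - q) * Z₀) *
            ((q * v₁ + (1 - q) * v₀) / (q * Z₁ + (1 - q) * Z₀))) -
      q * Z₁ * (w₁ / Z₁ - u₁ / Z₁ * (v₁ / Z₁)) -
      (1 - q) * Z₀ * (w₀ / Z₀ - u₀ / Z₀ * (v₀ / Z₀)) =
    (q * Z₁ + (1 - q) * Z₀) * (q * Z₁ / (q * Z₁ + (1 - q) * Z₀)) *
      (1 - q * Z₁ / (q * Z₁ + (1 - q) * Z₀)) * (u₁ / Z₁ - u₀ / Z₀) * (v₁ / Z₁ - v₀ / Z₀) := by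
  field_simp
  ring

variable (p : E → R) (ends : E → Sym2 V) (o a₁ a₂ a₃ b : V) (e : E)

omit [DecidableEq V] [LinearOrder R] [IsStrictOrderedRing R] in
/-- **`G = Gc / (D·Z)`** at the instance's own `γ`. -/
theorem Gcond_eq (hD : prob p (PDEvent ends a₁ a₂ a₃) ≠ 0)
    (hZ : prob p (avoidAll ends a₂ {a₁}) ≠ 0) :
    Gcond p ends o a₁ a₂ a₃ b (gam p ends o a₁ a₂ a₃) =
      Gc p ends o a₁ a₂ a₃ b / (prob p (PDEvent ends a₁ a₂ a₃) * prob p (avoidAll ends a₂ {a₁})) := by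
  unfold Gcond covQ covPD condEsbF condEsb condEF gam Gc DEF
  field_simp
  ring

omit [DecidableEq V] [LinearOrder R] [IsStrictOrderedRing R] in
/-- `γ` is the `π_D`-mixture of the children's `γ`: `γ = π_D γ¹ + (1 − π_D) γ⁰`, `π_D = q D¹/D`. -/
lemma gam_mix (hD : prob p (PDEvent ends a₁ a₂ a₃) ≠ 0)
    (hD1 : prob (Function.update p e 1) (PDEvent ends a₁ a₂ a₃) ≠ 0)
    (hD0 : prob (Function.update p e 0) (PDEvent ends a₁ a₂ a₃) ≠ 0) :
    gam p ends o a₁ a₂ a₃ =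
      p e * prob (Function.update p e 1) (PDEvent ends a₁ a₂ a₃) / prob p (PDEvent ends a₁ a₂ a₃) *
          gam (Function.update p e 1) ends o a₁ a₂ a₃ +
        (1 - p e * prob (Function.update p e 1) (PDEvent ends a₁ a₂ a₃) /
            prob p (PDEvent ends a₁ a₂ a₃)) *
          gam (Function.update p e 0) ends o a₁ a₂ a₃ := by
  have hDp := prob_eq_pin p (PDEvent ends a₁ a₂ a₃) e
  unfold gam
  rw [Do_pin p ends o a₁ a₂ a₃ e]
  rw [hDp] at hD ⊢
  field_simp
  ring

end Decomp

end Mix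

end Summit.Ventures.PercRepro2
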